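import Mathlib
import HarnessLib
import Summits.HubbardSuperconductivity.HubbardSuperconductivity.Theorems.KLProgrammeKLRegimeTwoVolumeLastScaleFrameExact

/-!
# Route `KLProgramme` — crux K3 ENGINE (stmt-HubbardSuperconductivity-20437 `KLRegimeEngineV17F2`), stub (e) proof-input «(e)-D-ROWS», keying (A′) (pen (R495)):
# THE DRESSING WEIGHT OF THE FRAME CONVERSION BELOW TEMPERATURE IS `m − 1 = −κ_D·Ψ_{K₁}` EXACTLY, pointwise `≤ |D|·β/π`
# (cell gate-hubbard-kl, seat hubbard-kl-k3c4-p1 g26, VL lane; memo DROWS-SCOPE-g26.md §14; the SYMBOL whose Fourier `ℓ¹` data `Rδ, Cδ, Cv` are the named inputs of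
# `…TwoVolumeDualRowsLastScaleConversion.hPe_lastScale_le` (p733418) — typed so that file (1c) starts from an explicit function)

Below temperature (`0 < Λ ≤ π/β`, in particular at `Λ = Λ_{nScales β + 1}`) k3c4-p2's `mismatchResummed_eq_uvSymbolCT_of_scale_le_pi_div` gives `Ψ̃ = Ψ_{K₁}`; hence the
external-leg dressing `m = (1 + Ψ_{K₂}κ_D)⁻¹` of the frame conversion satisfies, at EVERY label,

* **`dressWeight_sub_one_eq_of_scale_le_pi_div`** — `m − 1 = −κ_D·Ψ_{K₁}` (`κ_D = D(p_k⃗)/(βL²)`, `D = K₂ ⊖ K₁`): the weight `v − 1` of `…TwoVolumeFrameConversionRows`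
  at the last scale is minus the mismatch times the frame-`K₁` UV symbol — its overlap kernel is the convolution of the position kernel of the trigonometric polynomial `D`
  with the frame-`K₁` covariance above `Λ`;
* **`norm_dressWeight_sub_one_le`** — `‖m − 1‖ ≤ |D(p_k⃗)|·β/π` at every scale (k3c4-p2's `norm_frameDressing_le`);
* `dressWeight_sub_one_eq_lastScale`, `norm_dressWeight_sub_one_le_lastScale` — the same at `e₀ = klE0`, `n = nScales β + 1`.

Identities/inequalities only; nothing asserts the (D) rows, (e), VL, K3 or superconductivity.  References: Feldman–Salmhofer–Trubowitz 1996 §1 (counterterm dressing);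
BGM 2006 §2.3 (2.21)–(2.24) [cite: BenfattoGiulianiMastropietro2006]; Salmhofer 1999 §4.2.3 (temperature as infrared cutoff).
-/

noncomputable section

namespace Summit.HubbardSuperconductivity.HubbardSuperconductivity.Theorems.TwoVolumeDefect

set_option linter.dupNamespace false -- summit = problem name (single-conjunct summit), D-0017

open Finset Complex Literature.MathematicalPhysics.QuantumLattice Literature.Probability.LatticeModels
open Summit.HubbardSuperconductivity.HubbardSuperconductivity.Theorems.KLRegimeSplit
open Summit.HubbardSuperconductivity.HubbardSuperconductivity.Theorems.KLProgrammeLegKernels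

variable {L M : ℕ} [NeZero L]

section AnyScale

variable {β : ℝ} (hβ : 0 < β) (μ : ℝ) (K₁ K₂ : TrigPolyC4v) (Λ : ℝ)
include hβ

/-- **`‖m − 1‖ ≤ |D(p_k⃗)|·β/π` at EVERY scale `Λ`** (k3c4-p2's `norm_frameDressing_le` through `m − 1 = −κ_D·Ψ̃`; no smallness). [cite: FeldmanSalmhoferTrubowitz1996, §1] -/
theorem norm_dressWeight_sub_one_le (ks : FreqMomentum L M × Fin 2) :
    ‖(1 + uvSymbolCT L M β μ K₂ Λ ks * (((fsub K₂ K₁).eval (latticeMomentum L ks.1.2) / (β * (L : ℝ) ^ 2) : ℝ) : ℂ))⁻¹ - 1‖ ≤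
      |(fsub K₂ K₁).eval (latticeMomentum L ks.1.2)| * (β / Real.pi) := by
  obtain ⟨⟨i, kv⟩, σ⟩ := ks
  have hden := one_add_uvSymbolCT_mul_ofReal_ne_zero hβ μ K₂ Λ ((fsub K₂ K₁).eval (latticeMomentum L kv)) ((i, kv), σ)
  have h := norm_frameDressing_le hβ μ K₁ K₂ Λ i kv σ
  have heq : (1 + uvSymbolCT L M β μ K₂ Λ ((i, kv), σ) * (((fsub K₂ K₁).eval (latticeMomentum L kv) / (β * (L : ℝ) ^ 2) : ℝ) : ℂ))⁻¹ - 1 =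
      -((((fsub K₂ K₁).eval (latticeMomentum L kv) / (β * (L : ℝ) ^ 2) : ℝ) : ℂ) *
        (uvSymbolCT L M β μ K₂ Λ ((i, kv), σ) /
          (1 + uvSymbolCT L M β μ K₂ Λ ((i, kv), σ) * (((fsub K₂ K₁).eval (latticeMomentum L kv) / (β * (L : ℝ) ^ 2) : ℝ) : ℂ)))) := by
    field_simp
    ring
  simp only at heq ⊢
  rw [heq, norm_neg]
  exact h

end AnyScale

section BelowTemperature

variable {β : ℝ} (hβ : 0 < β) (μ : ℝ) (K₁ K₂ : TrigPolyC4v) (e₀ : ℝ) (n : ℕ)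
  (hΛ : 0 < klScale e₀ n) (hΛβ : klScale e₀ n ≤ Real.pi / β)
include hβ hΛ hΛβ

/-- **`m − 1 = −κ_D·Ψ_{K₁}` below temperature**: with `D = K₂ ⊖ K₁`, `κ_D(ks) = D(p_k⃗)/(βL²)`, `Ψ_K = uvSymbolCT … K Λ_n`, `0 < Λ_n ≤ π/β`:
`(1 + Ψ_{K₂}(ks)κ_D(ks))⁻¹ − 1 = −(κ_D(ks)·Ψ_{K₁}(ks))` at every label. [cite: FeldmanSalmhoferTrubowitz1996, §1] -/
theorem dressWeight_sub_one_eq_of_scale_le_pi_div (ks : FreqMomentum L M × Fin 2) :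
    (1 + uvSymbolCT L M β μ K₂ (klScale e₀ n) ks * (((fsub K₂ K₁).eval (latticeMomentum L ks.1.2) / (β * (L : ℝ) ^ 2) : ℝ) : ℂ))⁻¹ - 1 =
      -((((fsub K₂ K₁).eval (latticeMomentum L ks.1.2) / (β * (L : ℝ) ^ 2) : ℝ) : ℂ) * uvSymbolCT L M β μ K₁ (klScale e₀ n) ks) := by
  have hden := one_add_uvSymbolCT_mul_ofReal_ne_zero hβ μ K₂ (klScale e₀ n) ((fsub K₂ K₁).eval (latticeMomentum L ks.1.2)) ks
  have hΨ := congrFun (mismatchResummed_eq_uvSymbolCT_of_scale_le_pi_div hβ μ K₁ K₂ e₀ n hΛ hΛβ) ks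
  rw [← hΨ]
  field_simp
  ring

end BelowTemperature

section LastScale

variable {β : ℝ} (μ : ℝ) (K₁ K₂ : TrigPolyC4v)

/-- **`m − 1 = −κ_D·Ψ_{K₁}` at the VL reading scale** (`e₀ = klE0`, `n = nScales β + 1`; only `0 < β`). -/
theorem dressWeight_sub_one_eq_lastScale (hβ' : 0 < β) (ks : FreqMomentum L M × Fin 2) :
    (1 + uvSymbolCT L M β μ K₂ (klScale klE0 (nScales β + 1)) ks * (((fsub K₂ K₁).eval (latticeMomentum L ks.1.2) / (β * (L : ℝ) ^ 2) : ℝ) : ℂ))⁻¹ - 1 =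
      -((((fsub K₂ K₁).eval (latticeMomentum L ks.1.2) / (β * (L : ℝ) ^ 2) : ℝ) : ℂ) * uvSymbolCT L M β μ K₁ (klScale klE0 (nScales β + 1)) ks) :=
  dressWeight_sub_one_eq_of_scale_le_pi_div hβ' μ K₁ K₂ klE0 (nScales β + 1) klScale_nScales_succ_pos (klScale_nScales_succ_lt hβ').le ks

/-- **`‖m − 1‖ ≤ |D(p_k⃗)|·β/π` at the VL reading scale.** -/
theorem norm_dressWeight_sub_one_le_lastScale (hβ' : 0 < β) (ks : FreqMomentum L M × Fin 2) :
    ‖(1 + uvSymbolCT L M β μ K₂ (klScale klE0 (nScales β + 1)) ks * (((fsub K₂ K₁).eval (latticeMomentum L ks.1.2) / (β * (L : ℝ) ^ 2) : ℝ) : ℂ))⁻¹ - 1‖ ≤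
      |(fsub K₂ K₁).eval (latticeMomentum L ks.1.2)| * (β / Real.pi) :=
  norm_dressWeight_sub_one_le hβ' μ K₁ K₂ (klScale klE0 (nScales β + 1)) ks

end LastScale

end Summit.HubbardSuperconductivity.HubbardSuperconductivity.Theorems.TwoVolumeDefect

end
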